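import Summits.Ventures.LatticeQCDFlow.Scoring.FreeFieldHeatBathSpectrum
import Summits.Ventures.LatticeQCDFlow.Scoring.FreeFieldLeapfrog
import Summits.Ventures.LatticeQCDFlow.Exactness.FreeFieldOverrelaxationExact
import HarnessLib

/-!
# The engine's periodic `L₀ × L₁` lattice: plane phases, shifts without fixed points, and the free-field theorems instantiated

HONEST FRAMING: exact (Metropolis-corrected) sampling algorithms for lattice gauge theory;
figures of merit are autocorrelation/cost numbers at stated couplings and volumes; no
continuum-physics claim.  (SCALAR calibration rung S0-A: not a gauge result.)

Venture `LatticeQCDFlow` (cell pub-lqcd), sub-topic `Scoring`; FANOUT row 2 (`s0-phi4`).  NEW WORK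
of the cell (index bookkeeping over Mathlib's `finRotate` / `finProdFinEquiv`); nothing is cited
as a fact.

The row-2 free-field files (`SchwingerDysonSpectralOracle`, `…PlaneWaves`, `FreeFieldHeatBath`,
`…Spectrum`, `FreeFieldLeapfrog`, `Exactness/FreeFieldHeatBathExact`, `…OverrelaxationExact`)
are stated for ANY finite site set `Fin (n+1)` with commuting data: shift bijections `σ_μ` and a
PHASE HYPOTHESIS `θ(σ_μ x) ≡ θ(x) + k_μ (mod 2π)` (discharged so far only on the cycle,
`planePhase_finRotate`).  This file discharges everything for the engine's actual geometry, the
periodic `L₀ × L₁` lattice of `latflow.core.phi4_2d` (`L_μ = l_μ + 1`), through ANY enumeration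
`e : Fin (n+1) ≃ Fin L₀ × Fin L₁` of its sites (the row-major one, `torusEnum`, is Mathlib's
`finProdFinEquiv`; `n + 1 = L₀ L₁`).

## What is proved

* `torusShift e : Fin 2 → Equiv.Perm (Fin (n+1))` — the two unit translations (`finRotate` on
  one coordinate), `torusShift_zero_apply` / `torusShift_one_apply`; `torusPhase e j₀ j₁`
  (`θ(x) = 2πj₀x₀/L₀ + 2πj₁x₁/L₁`), `torusWave` (`k = (2πj₀/L₀, 2πj₁/L₁)`);
  **`torusPhase_shift`** — the phase hypothesis holds for every integer wave vector (from
  `planePhase_finRotate` coordinatewise); **`torusShift_ne_self`** — no translation fixes a site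
  when `L₀, L₁ ≥ 2` (`finRotate_ne_self`), the hypothesis of `shiftCoupling_diag`
  (`J_{xx} = 4 + m²`); `torus_latticeMomSq` (`k̂² = (2−2cos k₀) + (2−2cos k₁)`);
  `torus_cos_eigen` (`cos ∘ θ` is an eigenmode of the torus Laplacian, eigenvalue `k̂²`);
  `torusEnum l₀ l₁ : Fin ((l₀+1)l₁ + l₀ + 1) ≃ Fin (l₀+1) × Fin (l₁+1)`.
* Instances, now hypothesis-free on the torus (`m² > 0`; `L₀, L₁ ≥ 2` where the diagonal is
  needed): **`torus_structure_factor`** — `⟨|φ̃(k)|²⟩/V = 1/(2(m² + k̂²))` (the battery's T1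
  oracle, every integer `(j₀, j₁)`); **`torus_scanUpdate_cos`** — `cos(k·x)` is an exact
  eigenfunction of the random-scan `ω`-heat bath, factor `1 − ω(k̂² + m²)/(V(4 + m²))`;
  **`torus_tauInt_magnetisation`** — `τ_int(M)/V = 4/m² + 1 − 1/(2V)` sweeps (`z = 2`, amplitude
  `2d = 4`); **`torus_heatBath_exact`** / **`torus_overrelaxation_exact`** — the free-field law on
  the torus is invariant under the random-scan heat bath and under Adler's over-relaxation for
  every `ω ∈ (0, 2)`, for all bounded measurable observables; **`torus_leapfrog_cos`** — the qpq
  leapfrog step acts on the `cos(k·x)` components of `(φ, p)` by `lfMode δ (2(k̂² + m²))`;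
  `torusEnum_structure_factor` — the oracle for the concrete row-major enumeration.

NOT CLAIMED: `sin` companions are identical (`sin_phase_eigen`) and omitted; `λ > 0`; other
boundary conditions; dimensions `d ≠ 2` (the same two lemmas per extra `finRotate` factor).
-/

namespace Summit.Ventures.LatticeQCDFlow.Scoring

open Real Finset

section Torus

variable {n l₀ l₁ : ℕ}

/-- The two lattice shifts of the periodic `(l₀+1) × (l₁+1)` torus, transported to ANY enumeration
`e` of its sites by `Fin (n+1)`: direction `0` rotates the first coordinate, direction `1` the
second (`x ↦ x + e_μ mod L_μ`). -/
def torusShift (e : Fin (n + 1) ≃ Fin (l₀ + 1) × Fin (l₁ + 1)) : Fin 2 → Equiv.Perm (Fin (n + 1)) :=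
  ![(e.trans ((finRotate (l₀ + 1)).prodCongr (Equiv.refl _))).trans e.symm,
    (e.trans ((Equiv.refl _).prodCongr (finRotate (l₁ + 1)))).trans e.symm]

/-- The plane phase with integer wave numbers `(j₀, j₁)`:
`θ(x) = 2π j₀ x₀/L₀ + 2π j₁ x₁/L₁`. -/
noncomputable def torusPhase (e : Fin (n + 1) ≃ Fin (l₀ + 1) × Fin (l₁ + 1)) (j₀ j₁ : ℤ)
    (x : Fin (n + 1)) : ℝ :=
  2 * π * j₀ * ((e x).1 : ℕ) / (l₀ + 1) + 2 * π * j₁ * ((e x).2 : ℕ) / (l₁ + 1)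

/-- The wave vector `k = (2π j₀/L₀, 2π j₁/L₁)`. -/
noncomputable def torusWave (l₀ l₁ : ℕ) (j₀ j₁ : ℤ) : Fin 2 → ℝ :=
  ![2 * π * j₀ / (l₀ + 1), 2 * π * j₁ / (l₁ + 1)]

/-- First shift in coordinates. -/
theorem torusShift_zero_apply (e : Fin (n + 1) ≃ Fin (l₀ + 1) × Fin (l₁ + 1)) (x : Fin (n + 1)) :
    e (torusShift e 0 x) = (finRotate (l₀ + 1) (e x).1, (e x).2) := by
  simp only [torusShift, Matrix.cons_val_zero, Equiv.trans_apply, Equiv.apply_symm_apply]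
  rfl

/-- Second shift in coordinates. -/
theorem torusShift_one_apply (e : Fin (n + 1) ≃ Fin (l₀ + 1) × Fin (l₁ + 1)) (x : Fin (n + 1)) :
    e (torusShift e 1 x) = ((e x).1, finRotate (l₁ + 1) (e x).2) := by
  simp only [torusShift, Matrix.cons_val_one, Matrix.cons_val_zero,
    Equiv.trans_apply, Equiv.apply_symm_apply]
  rfl

/-- **The plane phases of the torus satisfy the phase hypothesis** of
`Scoring/SchwingerDysonPlaneWaves.lean`: `θ(σ_μ x) ≡ θ(x) + k_μ (mod 2π)` for both directions. -/
theorem torusPhase_shift (e : Fin (n + 1) ≃ Fin (l₀ + 1) × Fin (l₁ + 1)) (j₀ j₁ : ℤ) :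
    ∀ (μ : Fin 2) (x : Fin (n + 1)), ∃ m : ℤ,
      torusPhase e j₀ j₁ (torusShift e μ x)
        = torusPhase e j₀ j₁ x + torusWave l₀ l₁ j₀ j₁ μ + m * (2 * π) := by
  rw [Fin.forall_fin_two]
  constructor
  · intro x
    obtain ⟨m, hm⟩ := planePhase_finRotate (n := l₀) j₀ (e x).1
    refine ⟨m, ?_⟩
    unfold torusPhase
    rw [torusShift_zero_apply]
    simp only [torusWave, Matrix.cons_val_zero]
    rw [hm]
    ring
  · intro x
    obtain ⟨m, hm⟩ := planePhase_finRotate (n := l₁) j₁ (e x).2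
    refine ⟨m, ?_⟩
    unfold torusPhase
    rw [torusShift_one_apply]
    simp only [torusWave, Matrix.cons_val_one, Matrix.cons_val_zero]
    rw [hm]
    ring

/-- A rotation of `Fin (l+1)` with `l ≥ 1` has no fixed point. -/
theorem finRotate_ne_self {l : ℕ} (hl : 1 ≤ l) (y : Fin (l + 1)) : finRotate (l + 1) y ≠ y := by
  intro h
  have hv := congrArg Fin.val h
  by_cases hy : y = Fin.last l
  · subst hy
    rw [finRotate_last] at hv
    simp at hv
    omega
  · rw [coe_finRotate_of_ne_last hy] at hv
    omega

/-- **No shift fixes a site** as soon as both extents are `≥ 2` (`l₀, l₁ ≥ 1`): the hypothesis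
under which `J_{xx} = 2d + m²` (`shiftCoupling_diag`). -/
theorem torusShift_ne_self (e : Fin (n + 1) ≃ Fin (l₀ + 1) × Fin (l₁ + 1)) (h₀ : 1 ≤ l₀)
    (h₁ : 1 ≤ l₁) : ∀ (μ : Fin 2) (x : Fin (n + 1)), torusShift e μ x ≠ x := by
  rw [Fin.forall_fin_two]
  constructor
  · intro x h
    have he := congrArg e h
    rw [torusShift_zero_apply] at he
    exact finRotate_ne_self h₀ (e x).1 (congrArg Prod.fst he)
  · intro x h
    have he := congrArg e h
    rw [torusShift_one_apply] at he
    exact finRotate_ne_self h₁ (e x).2 (congrArg Prod.snd he)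

/-- The torus momentum `k̂² = (2 − 2cos k₀) + (2 − 2cos k₁)`. -/
theorem torus_latticeMomSq (l₀ l₁ : ℕ) (j₀ j₁ : ℤ) :
    ∑ μ, (2 - 2 * Real.cos (torusWave l₀ l₁ j₀ j₁ μ))
      = (2 - 2 * Real.cos (2 * π * j₀ / (l₀ + 1))) + (2 - 2 * Real.cos (2 * π * j₁ / (l₁ + 1))) := by
  rw [Fin.sum_univ_two]
  simp only [torusWave, Matrix.cons_val_zero, Matrix.cons_val_one]

/-- **`cos ∘ θ` is an eigenmode of the torus Laplacian** with eigenvalue `k̂²`. -/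
theorem torus_cos_eigen (e : Fin (n + 1) ≃ Fin (l₀ + 1) × Fin (l₁ + 1)) (j₀ j₁ : ℤ)
    (x : Fin (n + 1)) :
    ∑ μ, (2 * Real.cos (torusPhase e j₀ j₁ x) - Real.cos (torusPhase e j₀ j₁ (torusShift e μ x))
        - Real.cos (torusPhase e j₀ j₁ ((torusShift e μ).symm x)))
      = (∑ μ, (2 - 2 * Real.cos (torusWave l₀ l₁ j₀ j₁ μ))) * Real.cos (torusPhase e j₀ j₁ x) :=
  cos_phase_eigen (torusPhase_shift e j₀ j₁) x

/-- An enumeration of the torus sites by `Fin (n+1)`, `n + 1 = (l₀+1)(l₁+1)` (row-major,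
Mathlib's `finProdFinEquiv`). -/
def torusEnum (l₀ l₁ : ℕ) : Fin ((l₀ + 1) * l₁ + l₀ + 1) ≃ Fin (l₀ + 1) × Fin (l₁ + 1) :=
  (finCongr (by ring)).trans finProdFinEquiv.symm

end Torus

/-! ## The free-field theorems on the torus -/

section TorusFreeField

variable {n l₀ l₁ : ℕ}

/-- **The structure-factor oracle on the torus**: for `m² > 0`, `λ = 0` and every integer wave
vector, `⟨|φ̃(k)|²⟩ / V = 1 / (2(m² + k̂²))`, `k̂² = (2−2cos(2πj₀/L₀)) + (2−2cos(2πj₁/L₁))`. -/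
theorem torus_structure_factor (e : Fin (n + 1) ≃ Fin (l₀ + 1) × Fin (l₁ + 1)) {m2 : ℝ}
    (hm2 : 0 < m2) (j₀ j₁ : ℤ) :
    (gibbsExpect (shiftCoupling (torusShift e) m2) 0
        (fun φ => (∑ y, Real.cos (torusPhase e j₀ j₁ y) * φ y) ^ 2)
      + gibbsExpect (shiftCoupling (torusShift e) m2) 0
        (fun φ => (∑ y, Real.sin (torusPhase e j₀ j₁ y) * φ y) ^ 2)) / (n + 1 : ℝ)
      = 1 / (2 * (m2 + ((2 - 2 * Real.cos (2 * π * j₀ / (l₀ + 1)))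
          + (2 - 2 * Real.cos (2 * π * j₁ / (l₁ + 1)))))) := by
  rw [← torus_latticeMomSq]
  exact structure_factor_free_div (torusShift e) hm2 (torusPhase_shift e j₀ j₁)

/-- **The random-scan heat bath on the torus, mode by mode**: the plane wave `cos(k·x)` is an
eigenfunction of `P^ω` with factor `1 − ω(k̂² + m²)/(V(4 + m²))` (`d = 2`, `L₀, L₁ ≥ 2`,
`4 + m² ≠ 0`). -/
theorem torus_scanUpdate_cos (e : Fin (n + 1) ≃ Fin (l₀ + 1) × Fin (l₁ + 1)) (h₀ : 1 ≤ l₀)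
    (h₁ : 1 ≤ l₁) (m2 ω : ℝ) (hD : (4 : ℝ) + m2 ≠ 0) (j₀ j₁ : ℤ) (φ : Fin (n + 1) → ℝ) :
    scanUpdate (shiftCoupling (torusShift e) m2) ω
        (fun ψ => ∑ y, Real.cos (torusPhase e j₀ j₁ y) * ψ y) φ
      = scanFactor 2 (n + 1) m2 ((2 - 2 * Real.cos (2 * π * j₀ / (l₀ + 1)))
          + (2 - 2 * Real.cos (2 * π * j₁ / (l₁ + 1)))) ω
        * ∑ y, Real.cos (torusPhase e j₀ j₁ y) * φ y := by
  have hD' : 2 * (Fintype.card (Fin 2) : ℝ) + m2 ≠ 0 := by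
    rw [Fintype.card_fin]
    push_cast
    intro h
    exact hD (by linarith)
  have h := scanUpdate_eigenmode (torusShift e) m2 ω (torusShift_ne_self e h₀ h₁)
    hD' (torus_cos_eigen e j₀ j₁) φ
  rw [torus_latticeMomSq] at h
  simpa using h

/-- **`z = 2` on the torus**: under the random-scan heat bath of the free field on the periodic
`L₀ × L₁` lattice (`L₀, L₁ ≥ 2`, `m² > 0`, `V = L₀L₁`) the magnetisation has
`τ_int / V = 4/m² + 1 − 1/(2V)` sweeps, i.e. `4 ξ₂² + 1 − 1/(2V)`. -/
theorem torus_tauInt_magnetisation (V : ℕ) (hV : 0 < V) (m2 : ℝ) (hm2 : 0 < m2) :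
    tauInt (fun t => scanFactor 2 V m2 0 1 ^ t) / V = 4 * (1 / m2) + 1 - 1 / (2 * V) := by
  rw [tauInt_heatBath_magnetisation 2 V m2 hV hm2]
  norm_num

/-- **The heat bath is exact on the torus**: for `m² > 0`, `L₀, L₁ ≥ 2` and every bounded
measurable observable, `⟨P f⟩ = ⟨f⟩` under the free-field law. -/
theorem torus_heatBath_exact (e : Fin (n + 1) ≃ Fin (l₀ + 1) × Fin (l₁ + 1)) (h₀ : 1 ≤ l₀)
    (h₁ : 1 ≤ l₁) {m2 : ℝ} (hm2 : 0 < m2) {f : (Fin (n + 1) → ℝ) → ℝ} (hfm : Measurable f)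
    {B : ℝ} (hfb : ∀ φ, |f φ| ≤ B) :
    gibbsExpect (shiftCoupling (torusShift e) m2) 0 (scanUpdate (shiftCoupling (torusShift e) m2) 1 f)
      = gibbsExpect (shiftCoupling (torusShift e) m2) 0 f :=
  Exactness.heatBath_scan_exact_shift (torusShift e) hm2 (torusShift_ne_self e h₀ h₁) hfm hfb

/-- **Over-relaxation is exact on the torus**: every `ω ∈ (0, 2)`, `m² > 0`, `L₀, L₁ ≥ 2`,
bounded measurable `f`: `⟨P^ω f⟩ = ⟨f⟩`. -/
theorem torus_overrelaxation_exact (e : Fin (n + 1) ≃ Fin (l₀ + 1) × Fin (l₁ + 1)) (h₀ : 1 ≤ l₀)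
    (h₁ : 1 ≤ l₁) {m2 : ℝ} (hm2 : 0 < m2) {ω : ℝ} (hω0 : 0 < ω) (hω2 : ω < 2)
    {f : (Fin (n + 1) → ℝ) → ℝ} (hfm : Measurable f) {B : ℝ} (hfb : ∀ φ, |f φ| ≤ B) :
    gibbsExpect (shiftCoupling (torusShift e) m2) 0 (scanUpdate (shiftCoupling (torusShift e) m2) ω f)
      = gibbsExpect (shiftCoupling (torusShift e) m2) 0 f :=
  Exactness.overrelaxation_scan_exact_shift (torusShift e) hm2 (torusShift_ne_self e h₀ h₁)
    hω0 hω2 hfm hfb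

/-- **Leapfrog on the torus, mode by mode**: the `cos(k·x)` components of `(φ, p)` evolve under
one qpq step by the 2 × 2 map `lfMode δ Ω²`, `Ω² = 2(k̂² + m²)`. -/
theorem torus_leapfrog_cos (e : Fin (n + 1) ≃ Fin (l₀ + 1) × Fin (l₁ + 1)) (m2 δ : ℝ)
    (j₀ j₁ : ℤ) (φ p : Fin (n + 1) → ℝ) :
    ((∑ y, Real.cos (torusPhase e j₀ j₁ y)
        * (leapfrogQPQ (shiftCoupling (torusShift e) m2) 0 δ (φ, p)).1 y),
      (∑ y, Real.cos (torusPhase e j₀ j₁ y)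
        * (leapfrogQPQ (shiftCoupling (torusShift e) m2) 0 δ (φ, p)).2 y))
      = lfMode δ (2 * (((2 - 2 * Real.cos (2 * π * j₀ / (l₀ + 1)))
          + (2 - 2 * Real.cos (2 * π * j₁ / (l₁ + 1)))) + m2))
        (∑ y, Real.cos (torusPhase e j₀ j₁ y) * φ y, ∑ y, Real.cos (torusPhase e j₀ j₁ y) * p y) := by
  rw [← torus_latticeMomSq]
  exact leapfrog_mode (torusShift e) m2 δ (torus_cos_eigen e j₀ j₁) φ p

/-- **The concrete instance**: all of the above hold for the row-major enumeration `torusEnum`,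
e.g. the oracle on the `(l₀+1) × (l₁+1)` torus. -/
theorem torusEnum_structure_factor (l₀ l₁ : ℕ) {m2 : ℝ} (hm2 : 0 < m2) (j₀ j₁ : ℤ) :
    (gibbsExpect (shiftCoupling (torusShift (torusEnum l₀ l₁)) m2) 0
        (fun φ => (∑ y, Real.cos (torusPhase (torusEnum l₀ l₁) j₀ j₁ y) * φ y) ^ 2)
      + gibbsExpect (shiftCoupling (torusShift (torusEnum l₀ l₁)) m2) 0
        (fun φ => (∑ y, Real.sin (torusPhase (torusEnum l₀ l₁) j₀ j₁ y) * φ y) ^ 2))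
        / (((l₀ + 1) * l₁ + l₀ : ℕ) + 1 : ℝ)
      = 1 / (2 * (m2 + ((2 - 2 * Real.cos (2 * π * j₀ / (l₀ + 1)))
          + (2 - 2 * Real.cos (2 * π * j₁ / (l₁ + 1)))))) :=
  torus_structure_factor (torusEnum l₀ l₁) hm2 j₀ j₁

end TorusFreeField

end Summit.Ventures.LatticeQCDFlow.Scoring
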